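import Summits.AtomisticToContinuum.FouriersLaw.Theses.HoelderEscapeProfile

/-!
# Birth skeleton (`Lines/birth.lean`, BC3) for crux `FibreCalculus` (stmt-AtomisticToContinuum-16011)

Route `HoelderEscapeProfile` (sub-problem `FouriersLaw`), crux r7 `FibreCalculus` = the INFINITE-VOLUME FIBRE
CALCULUS OF THE ABEL ESCAPE PROFILE: for every guarded arena (pinned chain `pinnedChain ω₂ lam β γ`, `ω₂ lam β > 0`,
`T > 0`, a shift- and momentum-reversal-invariant DLR state `μ`, a `μ`-preserving shift-covariant infinite dynamics
`D`) and the route's named objects — split-bond site energy `h`, pulse `S(x,t) = Cov(h_0, h_x∘φ_t)`, Abel profile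
`S̄_ν(x) = ν∫₀^∞e^(−νt)S(x,t)dt` (`Sb`), current correlations `G(x,t) = ⟨j_0, j_x∘φ_t⟩`, fibred Abelian
conductivity `𝒢_ν(k)` (`Gh`), profile transform `f̂_ν(k)` (`fh`), static structure factor `χ(k)` (`χk`) — the
TWELVE clauses `closes` consumes: (1) absolutely convergent current correlations; (2) `e^(−νt)C_T ∈ L¹`;
(3) `e^(−νt)S(x,·) ∈ L¹`; (4) `Σ(1+x²)|S̄_ν| < ∞`; (5) `Σ(1+x²)|S(·,0)| < ∞`; (6) `χ(0) > 0`; (7) conservation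
`Σ_x S̄_ν(x) = χ(0)`; (8) Bochner `f̂_ν ≥ 0`; (9) Parseval at 0 `∫_(−π)^π f̂_ν = 2πS̄_ν(0)`; (10) `e^(−νt)Σ_x cos(kx)G(x,·)
∈ L¹`; (11) the k-space conservation law `χ(k) − f̂_ν(k) = (2−2cos k)𝒢_ν(k)/ν`; (12) Helfand–Abel
`∫e^(−νt)C_T = (ν/2)(Σx²S̄_ν − Σx²S(·,0))`.

## The line: FOUR MECHANISM-HOMOGENEOUS PACKAGES, the three redundant clauses proved here

* `stub_staticStructureFactor` (STATICS of the DLR state, size M): clustering with second moment of the static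
  energy–energy covariance `S₀(x) = Cov_μ(h_0, h_x)` and strict positivity of its sum `χ = Σ_x S₀(x) > 0`
  (`χ ≥ Var(p²/2) = T²/2`: momenta are i.i.d. Gaussian and independent of positions under a DLR state; the position
  part contributes a non-negative asymptotic variance). NO dynamics in the statement: the glue identifies the crux's
  `S(x,0)` (which is written through `φ_0`) with `S₀(x)` using `φ_0 = id` `μ`-a.e. (`PreservesMeasure.1`, `flow_zero`).
  Gives (5), (6).
* `stub_abelTemperedness` (LIGHT CONE / temperedness of the infinite dynamics in the Gibbs state, size L, HARDEST —
  it carries the "for EVERY guarded (μ, D)" cost): (1), (3), (4), (10).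
* `stub_bochnerPositivity` (POSITIVE TYPE, size M–L): given (4), `f̂_ν(k) = Σ_x cos(kx)S̄_ν(x) ≥ 0` — the Abel mean
  `ν∫e^(−νt)Cov(g, g∘φ_t)dt` of an autocorrelation under a measure-preserving flow is `≥ 0` (one Laplace integration of the
  doubly-integrated positive-type lemma `InfiniteChainDynamics.integral_Ioc_sub_mul_nonneg`, no Stone theorem), applied by shift invariance to
  `g = Σ_x c_x h_x`, then Fejér. Gives (8).
* `stub_conservationLawIdentities` (LOCAL ENERGY CONSERVATION `∂ₜ(h_x∘φ_t) = (j_(x−1) − j_x)∘φ_t`, momentum-reversal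
  evenness `∂ₜS(x,0) = 0`, hence `∂ₜ²S = Δ_xG`, two Abel integrations by parts; size L): given the temperedness package,
  the k-space conservation law (11) and its `k²`-coefficient, Helfand–Abel (12).
* PROVED HERE (no `sorry`): (7) is (11) at `k = 0` (`2 − 2cos 0 = 0`); (2) is (10) at `k = 0`
  (`C_T(t) = Σ_x G(x,t)` definitionally); (9) is real analysis from (4) — termwise integration of an absolutely
  summable cosine series on `[−π, π]` (`integral_cosSeries_eq`, dominated convergence + `∫_(−π)^π cos(kx)dk = 2π·[x=0]`).
* `FibreCalculus_of : stub_A → stub_B → stub_C → stub_D → FibreCalculus` — kernel-checked composition concluding the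
  crux BY NAME (`Registered.stub_x := type_of% stub_x`, so the hypotheses are the stub signatures by name; the
  `example` at the end type-checks the seam `FibreCalculus_of stub_… : FibreCalculus`).

Hardest stub: `stub_abelTemperedness`. Dependency shape: A, B free-standing; C and D take B's (and A's) outputs as
hypotheses (honest: positivity and the identities are claimed in the tempered regime the light cone provides).

## Disproof used
None exists: `ledger crux ls stmt-AtomisticToContinuum-16011` → "(no workfiles yet)" at registration (no
`Disproof.lean`, no `Negative/`, no ideas, no dead lines). `ledger negatives --problem AtomisticToContinuum`: the two
FouriersLaw negatives (OddCorrectorDecay stmt-9139, FarFieldGaussianity stmt-12890) concern other objects; no stub is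
an instance of a refuted statement. Harmonic calibration (`lam = β = 0`): all four packages HOLD there (the crux is
infrastructure; the route's harmonic failure sits in K1/AbelSpreadCeiling), consistent with `not_fouriersLawFor_harmonic`.
-/

noncomputable section

open MeasureTheory Filter Topology Set

namespace Summit.AtomisticToContinuum.FouriersLaw.Cruxes.FibreCalculus.Birth

open Literature.MathematicalPhysics.KineticTheory.HeatConduction
open Summit.AtomisticToContinuum.FouriersLaw.Theses.HoelderEscapeProfile (FibreCalculus)

set_option linter.unusedVariables false

/-! ### The registered stubs (`sorry` lives ONLY here)

Every stub opens with the crux's own guard telescope (verbatim spelling of `HoelderEscapeProfile.FibreCalculus`):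
parameters `ω₂ lam β > 0` (any `γ`), `T > 0`, a DLR state `μ` of `pinnedChain ω₂ lam β γ` at `T` that is shift
invariant and momentum-reversal invariant, and — for the dynamical stubs — an `InfiniteChainDynamics D` preserving
`μ` whose flow commutes with the shift `μ`-a.e.; the named objects are bound by their defining equations exactly as
in the crux, so the registered signatures are closed terms over tree declarations. -/

/-- STUB A `stub_staticStructureFactor` (size M; statics of the DLR state) — for the split-bond site energy
`h_x = p_x²/2 + U(q_x) + (V(q_(x+1)−q_x) + V(q_x−q_(x−1)))/2` and its STATIC covariance
`S₀(x) = ∫(h_0 − ⟨h_0⟩)(h_x − ⟨h_0⟩)dμ`: `Σ_x (1+x²)|S₀(x)| < ∞` (Gibbs clustering with second moment: transfer-operator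
spectral gap of the 1-D DLR state, `U ≥ ω₂q²/2`) and `0 < Σ_x S₀(x)` (`= T²c_v`; `≥ T²/2` from the i.i.d. Gaussian
momenta, the configurational asymptotic variance being `≥ 0`). No dynamics enters.
[cite: LanfordLebowitzLieb1977, §4] [cite: Georgii2011, Def. 1.23] [cite: BonettoLebowitzReyBellet2000, §7] -/
theorem stub_staticStructureFactor :
    ∀ ω₂ lam β γ : ℝ, 0 < ω₂ → 0 < lam → 0 < β → ∀ T : ℝ, 0 < T →
    ∀ μ : Measure ChainConfig, (pinnedChain ω₂ lam β γ).IsChainGibbsMeasure T μ → IsShiftInvariant μ →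
    μ.map (fun σ : ChainConfig => fun x : ℤ => ((σ x).1, -(σ x).2)) = μ →
    ∀ h : ChainConfig → ℤ → ℝ,
      h = (fun (σ : ChainConfig) (x : ℤ) => (σ x).2 ^ 2 / 2 + (pinnedChain ω₂ lam β γ).U (σ x).1 +
        ((pinnedChain ω₂ lam β γ).V ((σ (x + 1)).1 - (σ x).1) +
          (pinnedChain ω₂ lam β γ).V ((σ x).1 - (σ (x - 1)).1)) / 2) →
    ∀ S₀ : ℤ → ℝ,
      S₀ = (fun x : ℤ => ∫ σ, (h σ 0 - ∫ σ', h σ' 0 ∂μ) * (h σ x - ∫ σ', h σ' 0 ∂μ) ∂μ) →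
    Summable (fun x : ℤ => (1 + (x : ℝ) ^ 2) * |S₀ x|) ∧ 0 < ∑' x : ℤ, S₀ x := by
  sorry

/-- STUB B `stub_abelTemperedness` (size L; HARDEST — the light cone of the infinite dynamics in the Gibbs state, for
EVERY guarded `(μ, D)`) — (1) the current correlations `⟨j_0, j_x∘φ_t⟩` are absolutely summable in `x` at every `t`;
(3) `t ↦ e^(−νt)S(x,t)` is integrable on `(0,∞)` for every `x`, `ν > 0`; (4) the Abel profile has a finite second
moment, `Σ_x(1+x²)|S̄_ν(x)| < ∞`; (10) `t ↦ e^(−νt)Σ_x cos(kx)G(x,t)` is integrable on `(0,∞)` for every `k`, `ν > 0`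
(Abel-weighted light-cone bounds `Σ_x(1+x²)|S(x,t)| ≲ (1+t)^m` + Gibbs moments/clustering + joint measurability of
the flow). [cite: LanfordLebowitzLieb1977, §3 Thm 2] [cite: ButtaMarchioro2016] [cite: BonettoLebowitzReyBellet2000, §7 eq. (37)] -/
theorem stub_abelTemperedness :
    ∀ ω₂ lam β γ : ℝ, 0 < ω₂ → 0 < lam → 0 < β → ∀ T : ℝ, 0 < T →
    ∀ μ : Measure ChainConfig, (pinnedChain ω₂ lam β γ).IsChainGibbsMeasure T μ → IsShiftInvariant μ →
    μ.map (fun σ : ChainConfig => fun x : ℤ => ((σ x).1, -(σ x).2)) = μ →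
    ∀ D : InfiniteChainDynamics (pinnedChain ω₂ lam β γ), D.PreservesMeasure μ →
    (∀ t : ℝ, ∀ᵐ σ ∂μ, D.flow t (shift σ) = shift (D.flow t σ)) →
    ∀ h : ChainConfig → ℤ → ℝ,
      h = (fun (σ : ChainConfig) (x : ℤ) => (σ x).2 ^ 2 / 2 + (pinnedChain ω₂ lam β γ).U (σ x).1 +
        ((pinnedChain ω₂ lam β γ).V ((σ (x + 1)).1 - (σ x).1) +
          (pinnedChain ω₂ lam β γ).V ((σ x).1 - (σ (x - 1)).1)) / 2) →
    ∀ S : ℤ → ℝ → ℝ,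
      S = (fun (x : ℤ) (t : ℝ) =>
        ∫ σ, (h σ 0 - ∫ σ', h σ' 0 ∂μ) * (h (D.flow t σ) x - ∫ σ', h σ' 0 ∂μ) ∂μ) →
    ∀ Sb : ℝ → ℤ → ℝ,
      Sb = (fun (ν : ℝ) (x : ℤ) => ν * ∫ t in Ioi (0:ℝ), Real.exp (-(ν * t)) * S x t) →
    ∀ G : ℤ → ℝ → ℝ,
      G = (fun (x : ℤ) (t : ℝ) => ∫ σ, (pinnedChain ω₂ lam β γ).bondCurrentZ σ 0 *
        (pinnedChain ω₂ lam β γ).bondCurrentZ (D.flow t σ) x ∂μ) →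
    (∀ t : ℝ, D.HasAbsConvergentCorrelation μ t) ∧
    (∀ x : ℤ, ∀ ν : ℝ, 0 < ν →
      IntegrableOn (fun t : ℝ => Real.exp (-(ν * t)) * S x t) (Ioi 0)) ∧
    (∀ ν : ℝ, 0 < ν → Summable (fun x : ℤ => (1 + (x : ℝ) ^ 2) * |Sb ν x|)) ∧
    (∀ ν : ℝ, 0 < ν → ∀ k : ℝ,
      IntegrableOn (fun t : ℝ => Real.exp (-(ν * t)) * ∑' x : ℤ, Real.cos (k * (x : ℝ)) * G x t) (Ioi 0)) := by
  sorry

/-- STUB C `stub_bochnerPositivity` (size M–L; positive type) — in the tempered regime `Σ_x(1+x²)|S̄_ν(x)| < ∞` the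
profile transform is non-negative: `f̂_ν(k) = Σ_x cos(kx)S̄_ν(x) ≥ 0` for all `ν > 0`, `k ∈ ℝ`. Mechanism:
`x ↦ S̄_ν(x)` is positive-definite on `ℤ` — by shift invariance `Σ_(x,y) c_x c_y S̄_ν(x−y) = ν∫₀^∞e^(−νt)Cov(g, g∘φ_t)dt`
with `g = Σ_x c_x h_x`, and the Abel mean of an autocorrelation under a measure-preserving flow is `≥ 0`
(`ν∫e^(−νu)F(u)du = ν³∫₀^∞e^(−νt)(∫_(0,t](t−u)F(u)du)dt ≥ 0` by the doubly-integrated positive-type lemma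
`InfiniteChainDynamics.integral_Ioc_sub_mul_nonneg` of `Literature/…/InfiniteChainCurrentPositiveType` — no Stone theorem
needed); then Fejér/Herglotz for the (symmetrised) summable positive-definite sequence — evenness of `S̄_ν` in `x` is not
needed. [cite: BonettoLebowitzReyBellet2000, §7] [cite: Helfand1960] -/
theorem stub_bochnerPositivity :
    ∀ ω₂ lam β γ : ℝ, 0 < ω₂ → 0 < lam → 0 < β → ∀ T : ℝ, 0 < T →
    ∀ μ : Measure ChainConfig, (pinnedChain ω₂ lam β γ).IsChainGibbsMeasure T μ → IsShiftInvariant μ →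
    μ.map (fun σ : ChainConfig => fun x : ℤ => ((σ x).1, -(σ x).2)) = μ →
    ∀ D : InfiniteChainDynamics (pinnedChain ω₂ lam β γ), D.PreservesMeasure μ →
    (∀ t : ℝ, ∀ᵐ σ ∂μ, D.flow t (shift σ) = shift (D.flow t σ)) →
    ∀ h : ChainConfig → ℤ → ℝ,
      h = (fun (σ : ChainConfig) (x : ℤ) => (σ x).2 ^ 2 / 2 + (pinnedChain ω₂ lam β γ).U (σ x).1 +
        ((pinnedChain ω₂ lam β γ).V ((σ (x + 1)).1 - (σ x).1) +
          (pinnedChain ω₂ lam β γ).V ((σ x).1 - (σ (x - 1)).1)) / 2) →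
    ∀ S : ℤ → ℝ → ℝ,
      S = (fun (x : ℤ) (t : ℝ) =>
        ∫ σ, (h σ 0 - ∫ σ', h σ' 0 ∂μ) * (h (D.flow t σ) x - ∫ σ', h σ' 0 ∂μ) ∂μ) →
    ∀ Sb : ℝ → ℤ → ℝ,
      Sb = (fun (ν : ℝ) (x : ℤ) => ν * ∫ t in Ioi (0:ℝ), Real.exp (-(ν * t)) * S x t) →
    (∀ ν : ℝ, 0 < ν → Summable (fun x : ℤ => (1 + (x : ℝ) ^ 2) * |Sb ν x|)) →
    ∀ fh : ℝ → ℝ → ℝ, fh = (fun (ν k : ℝ) => ∑' x : ℤ, Real.cos (k * (x : ℝ)) * Sb ν x) →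
    ∀ ν : ℝ, 0 < ν → ∀ k : ℝ, 0 ≤ fh ν k := by
  sorry

/-- STUB D `stub_conservationLawIdentities` (size L; local energy conservation) — in the tempered regime (the four
outputs of `stub_abelTemperedness` and the static clustering of `stub_staticStructureFactor`, listed as hypotheses):
(11) the k-SPACE CONSERVATION LAW `χ(k) − f̂_ν(k) = (2−2cos k)𝒢_ν(k)/ν` for all `ν > 0`, `k`, and (12) HELFAND–ABEL
`∫₀^∞e^(−νt)C_T(t)dt = (ν/2)(Σ_x x²S̄_ν(x) − Σ_x x²S(x,0))`. Mechanism: `d/dt (h_x∘φ_t) = (j_(x−1) − j_x)∘φ_t` for the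
split-bond energy and the bond current `j_x = −½(p_x+p_(x+1))V′(q_(x+1)−q_x)`, stationarity and momentum-reversal
evenness (`∂ₜS(x,0) = 0`) give `∂ₜ²S = Δ_xG`; two Abel integrations by parts give `ν(S̄_ν − S(·,0)) = Δ_xG_ν`, whose
cosine transform is (11) and whose second k-moment at `0` is (12) (`C_T = Σ_xG(x,·)`).
[cite: Helfand1960] [cite: BonettoLebowitzReyBellet2000, §7 eq. (37)] [cite: arXiv:1103.2835] -/
theorem stub_conservationLawIdentities :
    ∀ ω₂ lam β γ : ℝ, 0 < ω₂ → 0 < lam → 0 < β → ∀ T : ℝ, 0 < T →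
    ∀ μ : Measure ChainConfig, (pinnedChain ω₂ lam β γ).IsChainGibbsMeasure T μ → IsShiftInvariant μ →
    μ.map (fun σ : ChainConfig => fun x : ℤ => ((σ x).1, -(σ x).2)) = μ →
    ∀ D : InfiniteChainDynamics (pinnedChain ω₂ lam β γ), D.PreservesMeasure μ →
    (∀ t : ℝ, ∀ᵐ σ ∂μ, D.flow t (shift σ) = shift (D.flow t σ)) →
    ∀ h : ChainConfig → ℤ → ℝ,
      h = (fun (σ : ChainConfig) (x : ℤ) => (σ x).2 ^ 2 / 2 + (pinnedChain ω₂ lam β γ).U (σ x).1 +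
        ((pinnedChain ω₂ lam β γ).V ((σ (x + 1)).1 - (σ x).1) +
          (pinnedChain ω₂ lam β γ).V ((σ x).1 - (σ (x - 1)).1)) / 2) →
    ∀ S : ℤ → ℝ → ℝ,
      S = (fun (x : ℤ) (t : ℝ) =>
        ∫ σ, (h σ 0 - ∫ σ', h σ' 0 ∂μ) * (h (D.flow t σ) x - ∫ σ', h σ' 0 ∂μ) ∂μ) →
    ∀ Sb : ℝ → ℤ → ℝ,
      Sb = (fun (ν : ℝ) (x : ℤ) => ν * ∫ t in Ioi (0:ℝ), Real.exp (-(ν * t)) * S x t) →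
    ∀ G : ℤ → ℝ → ℝ,
      G = (fun (x : ℤ) (t : ℝ) => ∫ σ, (pinnedChain ω₂ lam β γ).bondCurrentZ σ 0 *
        (pinnedChain ω₂ lam β γ).bondCurrentZ (D.flow t σ) x ∂μ) →
    ∀ Gh : ℝ → ℝ → ℝ,
      Gh = (fun (ν k : ℝ) =>
        ∫ t in Ioi (0:ℝ), Real.exp (-(ν * t)) * ∑' x : ℤ, Real.cos (k * (x : ℝ)) * G x t) →
    ∀ fh : ℝ → ℝ → ℝ, fh = (fun (ν k : ℝ) => ∑' x : ℤ, Real.cos (k * (x : ℝ)) * Sb ν x) →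
    ∀ χk : ℝ → ℝ, χk = (fun k : ℝ => ∑' x : ℤ, Real.cos (k * (x : ℝ)) * S x 0) →
    (∀ t : ℝ, D.HasAbsConvergentCorrelation μ t) →
    (∀ x : ℤ, ∀ ν : ℝ, 0 < ν →
      IntegrableOn (fun t : ℝ => Real.exp (-(ν * t)) * S x t) (Ioi 0)) →
    (∀ ν : ℝ, 0 < ν → Summable (fun x : ℤ => (1 + (x : ℝ) ^ 2) * |Sb ν x|)) →
    Summable (fun x : ℤ => (1 + (x : ℝ) ^ 2) * |S x 0|) →
    (∀ ν : ℝ, 0 < ν → ∀ k : ℝ,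
      IntegrableOn (fun t : ℝ => Real.exp (-(ν * t)) * ∑' x : ℤ, Real.cos (k * (x : ℝ)) * G x t) (Ioi 0)) →
    (∀ ν : ℝ, 0 < ν → ∀ k : ℝ, χk k - fh ν k = (2 - 2 * Real.cos k) * Gh ν k / ν) ∧
    (∀ ν : ℝ, 0 < ν → ∫ t in Ioi (0:ℝ), Real.exp (-(ν * t)) * D.currentCorrelation μ t =
      ν / 2 * ((∑' x : ℤ, (x : ℝ) ^ 2 * Sb ν x) - ∑' x : ℤ, (x : ℝ) ^ 2 * S x 0)) := by
  sorry

/-! ### By-name statements of the registered stubs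

`Registered.stub_x` is DEFINITIONALLY the statement of the sorried `theorem stub_x` (`type_of%`), so the composition
`FibreCalculus_of : Registered.stub_staticStructureFactor → … → FibreCalculus` is literally "stub signatures → crux"
(the skeleton audit reads the hypotheses by name) and the closing `example` type-checks the seam. -/

namespace Registered

/-- Statement of registered stub A (`stub_staticStructureFactor`), by name. -/
def stub_staticStructureFactor : Prop := type_of% Birth.stub_staticStructureFactor

/-- Statement of registered stub B (`stub_abelTemperedness`), by name. -/
def stub_abelTemperedness : Prop := type_of% Birth.stub_abelTemperedness

/-- Statement of registered stub C (`stub_bochnerPositivity`), by name. -/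
def stub_bochnerPositivity : Prop := type_of% Birth.stub_bochnerPositivity

/-- Statement of registered stub D (`stub_conservationLawIdentities`), by name. -/
def stub_conservationLawIdentities : Prop := type_of% Birth.stub_conservationLawIdentities

end Registered

/-! ### Real analysis (no `sorry`): Parseval at zero for an absolutely summable cosine series -/

/-- Orthogonality of the modes `cos(k·x)`, `x ∈ ℤ`, on `[−π, π]`: termwise integration (dominated convergence with
the constant majorant `|c x|`) of an absolutely summable cosine series picks out `2π·c 0`, because
`∫_(−π)^π cos(kx)dk = (sin(πx) − sin(−πx))/x = 0` for `x ≠ 0` and `= 2π` for `x = 0`. [folklore] -/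
theorem integral_cosSeries_eq (c : ℤ → ℝ) (hc : Summable fun x : ℤ => |c x|) :
    ∫ k in (-Real.pi)..Real.pi, ∑' x : ℤ, Real.cos (k * (x : ℝ)) * c x = 2 * Real.pi * c 0 := by
  -- each mode separately
  have hmode : ∀ x : ℤ, ∫ k in (-Real.pi)..Real.pi, Real.cos (k * (x : ℝ)) * c x
      = if x = 0 then 2 * Real.pi * c 0 else 0 := by
    intro x
    rw [intervalIntegral.integral_mul_const]
    split_ifs with hx
    · subst hx
      simp only [Int.cast_zero, mul_zero, Real.cos_zero, intervalIntegral.integral_const, smul_eq_mul, mul_one]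
      ring
    · have hx' : (x : ℝ) ≠ 0 := by exact_mod_cast hx
      have h1 : Real.sin (Real.pi * (x : ℝ)) = 0 := by
        rw [mul_comm]; exact Real.sin_int_mul_pi x
      have h2 : Real.sin (-Real.pi * (x : ℝ)) = 0 := by
        rw [neg_mul, Real.sin_neg, h1, neg_zero]
      rw [intervalIntegral.integral_comp_mul_right Real.cos hx', integral_cos, h1, h2]
      simp
  -- the pointwise bound `|cos(kx) c x| ≤ |c x|`
  have hbd : ∀ (x : ℤ) (k : ℝ), ‖Real.cos (k * (x : ℝ)) * c x‖ ≤ |c x| := fun x k => by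
    rw [Real.norm_eq_abs, abs_mul]
    exact mul_le_of_le_one_left (abs_nonneg _) (Real.abs_cos_le_one _)
  -- termwise integration
  have hsum : HasSum (fun x : ℤ => ∫ k in (-Real.pi)..Real.pi, Real.cos (k * (x : ℝ)) * c x)
      (∫ k in (-Real.pi)..Real.pi, ∑' x : ℤ, Real.cos (k * (x : ℝ)) * c x) := by
    refine intervalIntegral.hasSum_integral_of_dominated_convergence (fun x _ => |c x|)
      (fun x => ?_) (fun x => ?_) ?_ ?_ ?_
    · exact ((Real.continuous_cos.comp (continuous_id.mul continuous_const)).mul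
        continuous_const).aestronglyMeasurable
    · exact Eventually.of_forall fun k _ => hbd x k
    · exact Eventually.of_forall fun k _ => hc
    · exact intervalIntegrable_const
    · exact Eventually.of_forall fun k _ => (Summable.of_norm_bounded hc (fun x => hbd x k)).hasSum
  have hite : HasSum (fun x : ℤ => if x = 0 then 2 * Real.pi * c 0 else (0 : ℝ))
      (∫ k in (-Real.pi)..Real.pi, ∑' x : ℤ, Real.cos (k * (x : ℝ)) * c x) := by
    simp only [hmode] at hsum
    exact hsum
  exact hite.unique (hasSum_ite_eq (0 : ℤ) (2 * Real.pi * c 0))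

/-! ### The composition (kernel-checked, no `sorry`): the four packages give the crux BY NAME -/

/-- `stub_staticStructureFactor → stub_abelTemperedness → stub_bochnerPositivity → stub_conservationLawIdentities →
FibreCalculus`. Plumbing plus three proved reductions: (2) = (10) at `k = 0` (`C_T = Σ_xG` by `rfl`); (7) = (11) at
`k = 0`; (9) = `integral_cosSeries_eq` from (4); and `S(x,0) = S₀(x)` by `φ_0 = id` a.e. [folklore] -/
theorem FibreCalculus_of (hA : Registered.stub_staticStructureFactor) (hB : Registered.stub_abelTemperedness)
    (hC : Registered.stub_bochnerPositivity) (hD : Registered.stub_conservationLawIdentities) :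
    FibreCalculus := by
  intro ω₂ lam β γ hω hl hβ T hT μ hG hSI hRefl D hP hShift h hh S hS Sb hSb G hGd Gh hGh fh hfh χk hχk
  -- (1), (3), (4), (10): the temperedness package
  obtain ⟨hAC, hIntS, hSumSb, hIntG⟩ :=
    hB ω₂ lam β γ hω hl hβ T hT μ hG hSI hRefl D hP hShift h hh S hS Sb hSb G hGd
  -- (5), (6): statics — `S x 0` is the static covariance since `φ_0 = id` `μ`-a.e.
  have hS0 : (fun x : ℤ => S x 0) =
      (fun x : ℤ => ∫ σ, (h σ 0 - ∫ σ', h σ' 0 ∂μ) * (h σ x - ∫ σ', h σ' 0 ∂μ) ∂μ) := by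
    funext x
    simp only [hS]
    refine integral_congr_ae ?_
    filter_upwards [hP.1] with σ hσ
    rw [D.flow_zero σ hσ]
  obtain ⟨hSumS0, hχpos⟩ := hA ω₂ lam β γ hω hl hβ T hT μ hG hSI hRefl h hh (fun x : ℤ => S x 0) hS0
  have hSumS0' : Summable (fun x : ℤ => (1 + (x : ℝ) ^ 2) * |S x 0|) := by simpa using hSumS0
  have hχ0 : χk 0 = ∑' x : ℤ, S x 0 := by
    simp only [hχk, zero_mul, Real.cos_zero, one_mul]
  have hχpos' : 0 < χk 0 := by rw [hχ0]; simpa using hχpos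
  -- (8): Bochner positivity in the tempered regime
  have hBoch : ∀ ν : ℝ, 0 < ν → ∀ k : ℝ, 0 ≤ fh ν k :=
    hC ω₂ lam β γ hω hl hβ T hT μ hG hSI hRefl D hP hShift h hh S hS Sb hSb hSumSb fh hfh
  -- (11), (12): the conservation-law identities in the tempered regime
  obtain ⟨hId, hHelf⟩ :=
    hD ω₂ lam β γ hω hl hβ T hT μ hG hSI hRefl D hP hShift h hh S hS Sb hSb G hGd Gh hGh fh hfh χk hχk
      hAC hIntS hSumSb hSumS0' hIntG
  -- (2) from (10) at `k = 0`
  have hIntC : ∀ ν : ℝ, 0 < ν →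
      IntegrableOn (fun t : ℝ => Real.exp (-(ν * t)) * D.currentCorrelation μ t) (Ioi 0) := by
    intro ν hν
    have h0 := hIntG ν hν 0
    simp only [zero_mul, Real.cos_zero, one_mul, hGd] at h0
    exact h0
  -- (7) from (11) at `k = 0`
  have hcons : ∀ ν : ℝ, 0 < ν → ∑' x : ℤ, Sb ν x = χk 0 := by
    intro ν hν
    have e := hId ν hν 0
    have hf0 : fh ν 0 = ∑' x : ℤ, Sb ν x := by
      simp only [hfh, zero_mul, Real.cos_zero, one_mul]
    rw [Real.cos_zero, hf0] at e
    have hz : (2 - 2 * (1 : ℝ)) * Gh ν 0 / ν = 0 := by ring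
    linarith
  -- (9) Parseval at zero from (4)
  have hPars : ∀ ν : ℝ, 0 < ν → ∫ k in (-Real.pi)..Real.pi, fh ν k = 2 * Real.pi * Sb ν 0 := by
    intro ν hν
    have habs : Summable fun x : ℤ => |Sb ν x| :=
      Summable.of_nonneg_of_le (fun x => abs_nonneg _)
        (fun x => le_mul_of_one_le_left (abs_nonneg _) (by nlinarith [sq_nonneg (x : ℝ)])) (hSumSb ν hν)
    simp only [hfh]
    exact integral_cosSeries_eq (Sb ν) habs
  exact ⟨hAC, hIntC, hIntS, hSumSb, hSumS0', hχpos', hcons, hBoch, hPars, hIntG, hId, hHelf⟩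

/-- Type-check of the seam (an `example`, adds nothing to the environment): the sorried stubs are literally the
antecedents of `FibreCalculus_of`. -/
example : FibreCalculus :=
  FibreCalculus_of stub_staticStructureFactor stub_abelTemperedness stub_bochnerPositivity
    stub_conservationLawIdentities

end Summit.AtomisticToContinuum.FouriersLaw.Cruxes.FibreCalculus.Birth

end
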